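import Literature.NumberTheory.IwasawaTheory.ZpExtensionTotallyRamifiedFromLayerOne
import Literature.NumberTheory.EllipticCurves.CyclotomicZpExtensionLayerOneSqrtTwoProofs
import Literature.NumberTheory.EllipticCurves.ZpExtensionRestrictLayers
import Literature.NumberTheory.EllipticCurves.ZpExtensionRestrictCyclotomic
import Literature.NumberTheory.EllipticCurves.ZpExtensionRestrictTwoSqrtTwo
import Literature.NumberTheory.EllipticCurves.ZpExtensionUnitTwistProofs
import HarnessLib

/-!
# The cyclotomic `ℤ₂`-extension of a number field CONTAINING `√−1`: `ζ₈ ∈ F₁`, the ramification indices of the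
# primes of `F₁` above `2` are divisible by `4`, and Fukuda's index is `0` as soon as no prime of `F` above `2` has
# `4 ∣ e(w|2)` (e.g. `F = E(√−1)` for `E` of odd degree with ONE prime above `2`)

Topic `Literature/NumberTheory/IwasawaTheory`, namespace `Literature.NumberTheory.IwasawaTheory`.  THEOREMS ONLY
(no definition, no named fact, no instance; D-0026).  Companion of `CyclotomicTwoTotallyRamifiedOddIndex.lean` (odd-degree
base: `√2 ∈ K₁`, EVEN `e(Q|2)`, Fukuda index `0` from ODD `e(w|2)`) for base fields of EVEN degree `2·odd` that contain
`i = √−1` (so `e(w|2)` is even for every `w ∣ 2` and the parity discharge is void): one level deeper, `ζ₈ = (1+i)/√2 ∈ F₁`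
forces `4 ∣ e(Q|2)`, and `4 ∤ e(w|2)` downstairs forces ramification of `w` in `F₁`.

## What and why (cell `bsd-2adic`, K4 crux C1″ `FineSelmerConjAAtTwoAdditivePotGood`, stmt-BirchSwinnertonDyer-22615)

For the `Δ > 0` rows of the additive census the honest carrier of Coates–Sujatha's statement (A) at `2` is the totally
imaginary sextic `F = ℚ(P, i)` over the totally real cubic point field `ℚ(P)` (the tree's `…ConjATwoOfPointFieldMu` door takes
`μ₂(F^{cyc}) = 0` as its only input).  Fukuda's two-layer criterion (tree, kernel: `fukuda1994_thm1_classGroupPRank_const_of_succ_eq_holds`)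
for THAT tower carries the structural binder `TotallyRamifiedFrom κ 0`, discharged here:

* §1 `four_dvd_ramificationIdx_int_of_pow_four_eq_neg_one` — if `z⁴ = −1` in `𝓞 L` then `4 ∣ e(Q|2)` for every prime `Q ∣ 2`
  of `𝓞 L` (`2𝓞_L = (1 − z)⁴`: `(1 − z)⁴ = 2·z²(y − 1)²` with `y = z − z³`, `y² = 2`, a unit factor).
* §2 `sq_ne_two_of_sq_eq_neg_one_of_not_four_dvd_finrank` — `√2 ∉ F` when `i ∈ F` and `4 ∤ [F:ℚ]` (else `ζ₈ ∈ F`, so `4 ∣ e(Q|2) ∣`-free: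
  we argue by degrees, `[ℚ(ζ₈):ℚ] = 4`); hence the cyclotomic `ℤ₂`-extension of `ℚ` restricts ONTO `Γ_F`
  (`surjective_comp_absGaloisRestrict_of_sq_eq_neg_one`), and **`exists_pow_four_eq_neg_one_layer_one`**: every cyclotomic
  `ℤ₂`-extension `κ` of `F` has some `z ∈ F₁ = κ.layer 1` with `z⁴ = −1` (`√2 ∈ ℚ_1 ↪ F₁`, `i ∈ F ⊆ F₁`, `z = (1+i)√2/2`).
* §3 **`not_isUnramifiedIn_layer_one_of_not_four_dvd_ramificationIdx`** and
  **`totallyRamifiedFrom_zero_of_sq_eq_neg_one_of_forall_not_four_dvd`** — for `F ∋ i` with `4 ∤ [F:ℚ]` and `κ` cyclotomic: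
  a place `w ∣ 2` with `4 ∤ e(w|2)` ramifies in `F₁` (`e(Q|2) = e(w|2)·e(Q|w)`), so if EVERY `w ∣ 2` has `4 ∤ e(w|2)` then
  `TotallyRamifiedFrom κ 0`; in particular (`totallyRamifiedFrom_zero_of_sq_eq_neg_one_of_existsUnique`) when `F` has exactly
  ONE prime above `2` (then `e·f = [F:ℚ] = 2·odd`).

No elliptic curve occurs here; BSD is not advanced by this file.

References: [Washington1997] §13.1 (`ℚ_1 = ℚ(√2)`; layers of `L·K_∞`), Lemma 13.3; [Fukuda1994] p. 264 (the index `n₀`);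
[NeukirchANT1999] Ch. I §8 (multiplicativity of `e`), Ch. I (10.1) (`2 = unit·(1−ζ₈)⁴` in `ℤ[ζ₈]`).
-/

noncomputable section

open scoped NumberField Pointwise IntermediateField
open Multiplicative Polynomial UniqueFactorizationMonoid

namespace Literature.NumberTheory.IwasawaTheory

open Literature.NumberTheory.EllipticCurves Literature.NumberTheory.EllipticCurves.ZpExtension
  Literature.NumberTheory.GaloisRepresentations Field IsDedekindDomain NumberField

/-! ## §1 `z⁴ = −1` forces `4 ∣ e(Q|2)` -/

section EighthRoot

variable {L : Type*} [Field L] [NumberField L]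

/-- **`4 ∣ e(Q | 2ℤ)` when `𝓞_L` contains a primitive eighth root of unity.**  If `z⁴ = −1` in `𝓞 L` then for every prime
`Q` of `𝓞 L` above `2` the ramification index `e(Q|2)` is divisible by `4`: with `y = z − z³` one has `y² = 2` and
`(1 − z)⁴ = 2 · z²(y − 1)²` with `z²(y−1)²` a unit (`(y − 1)(y + 1) = 1`), so `2𝓞_L = ((1 − z)𝓞_L)⁴` and the exponent of `Q`
in `2𝓞_L` is four times that in `(1 − z)`. [cite: NeukirchANT1999, Ch. I §10, Lemma (10.1) (`p = ε(1−ζ)^{φ(p^ν)}`), Ch. I §8 Prop. (8.2)] -/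
theorem four_dvd_ramificationIdx_int_of_pow_four_eq_neg_one {z : 𝓞 L} (hz : z ^ 4 = -1) (Q : Ideal (𝓞 L))
    [Q.IsPrime] [Q.LiesOver (Ideal.span {(2 : ℤ)})] : 4 ∣ Q.ramificationIdx ℤ := by
  classical
  set y : 𝓞 L := z - z ^ 3 with hy
  set w : 𝓞 L := z ^ 2 * (y - 1) ^ 2 with hw
  have hkey : (1 - z) ^ 4 = 2 * w := by
    rw [hw, hy]; linear_combination (1 - 4 * z + 4 * z ^ 2 - 2 * z ^ 4) * hz
  have hwu : IsUnit w := by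
    refine isUnit_iff_exists_inv.mpr ⟨-(z ^ 2 * (y + 1) ^ 2), ?_⟩
    rw [hw, hy]; linear_combination (-1 + 2 * z ^ 6 - 5 * z ^ 8 + 4 * z ^ 10 - z ^ 12) * hz
  have hmap : (Ideal.span {(2 : ℤ)}).map (algebraMap ℤ (𝓞 L)) = (Ideal.span {1 - z}) ^ 4 := by
    rw [Ideal.map_span, Set.image_singleton, map_ofNat, Ideal.span_singleton_pow, hkey]
    exact (Ideal.span_singleton_mul_right_unit hwu 2).symm
  have hne : (Ideal.span {(2 : ℤ)}).map (algebraMap ℤ (𝓞 L)) ≠ ⊥ := by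
    rw [Ne, Ideal.map_eq_bot_iff_of_injective (algebraMap ℤ (𝓞 L)).injective_int, Ideal.span_singleton_eq_bot]
    norm_num
  rw [Ideal.IsDedekindDomain.ramificationIdx_eq_normalizedFactors_count (Ideal.span {(2 : ℤ)}) Q hne,
    hmap, normalizedFactors_pow, Multiset.count_nsmul]
  exact Dvd.intro _ rfl

end EighthRoot

/-! ## §2 `√2 ∉ F` and `ζ₈ ∈ F₁` for a base field `F ∋ √−1` with `4 ∤ [F:ℚ]` -/

section LayerOne

variable {F : Type} [Field F] [NumberField F]

/-- **`√2 ∉ F` when `√−1 ∈ F` and `4 ∤ [F:ℚ]`**: from `x² = −1`, `s² = 2` in `F` the element `z = (1 + x)s/2` satisfies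
`z⁴ = −1`, so `ℚ(z) ≅ ℚ(ζ₈)` has degree `4` dividing `[F:ℚ]`. [cite: Washington1997, §13.1 and Ch. 2 (`[ℚ(ζ₈):ℚ] = 4`)] -/
theorem sq_ne_two_of_sq_eq_neg_one_of_not_four_dvd_finrank {x : F} (hx : x ^ 2 = -1)
    (h4 : ¬ 4 ∣ Module.finrank ℚ F) (s : F) : s ^ 2 ≠ 2 := by
  intro hs
  set z : F := (1 + x) * s / 2 with hz
  have hz4 : z ^ 4 = -1 := by
    rw [hz]
    have : ((1 + x) * s / 2) ^ 4 = ((1 + x) ^ 2) ^ 2 * (s ^ 2) ^ 2 / 16 := by ring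
    rw [this, hs]
    have h1 : (1 + x) ^ 2 = 2 * x := by linear_combination hx
    rw [h1]
    linear_combination (1 : F) * hx
  have hz8 : IsPrimitiveRoot z 8 := by
    refine IsPrimitiveRoot.mk_of_lt z (by norm_num) (by rw [show (8 : ℕ) = 4 * 2 by rfl, pow_mul, hz4]; norm_num) ?_
    intro k hk hk8 hk1
    have hne : ∀ j : ℕ, j < 4 → 0 < j → z ^ j ≠ 1 ∧ z ^ j ≠ -1 := by
      -- `z^4 = -1`: if `z^j = ± 1` with `0 < j < 4` then `z^{4} = z^{4-j} z^j`, contradiction by cases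
      intro j hj hj0
      have hz2 : z ^ 2 ≠ 1 ∧ z ^ 2 ≠ -1 := by
        constructor
        · intro h; have : z ^ 4 = 1 := by rw [show (4:ℕ) = 2 * 2 by rfl, pow_mul, h, one_pow]
          rw [hz4] at this; norm_num at this
        · intro h
          -- z^2 = -1 ⟹ z = (1+x)s/2 with z² = (1+x)² s²/4 = 2x·2/4 = x; so x = -1, x² = 1 ≠ -1
          have hz2x : z ^ 2 = x := by
            rw [hz]
            have : ((1 + x) * s / 2) ^ 2 = (1 + x) ^ 2 * s ^ 2 / 4 := by ring
            rw [this, hs]; linear_combination (1/2 : F) * hx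
          rw [hz2x] at h; rw [h] at hx; norm_num at hx
      interval_cases j
      · refine ⟨fun h => ?_, fun h => ?_⟩
        · rw [pow_one] at h; rw [h] at hz4; norm_num at hz4
        · rw [pow_one] at h; rw [h] at hz4; norm_num at hz4
      · exact hz2
      · refine ⟨fun h => ?_, fun h => ?_⟩
        · have : z ^ 4 = z := by rw [pow_succ, h, one_mul]
          rw [hz4] at this
          have h2 : z ^ 2 = 1 := by rw [← this]; norm_num
          exact hz2.1 h2
        · have : z ^ 4 = -z := by rw [pow_succ, h]; ring
          rw [hz4] at this
          have h2 : z ^ 2 = 1 := by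
            have : z = 1 := by linear_combination this
            rw [this]; norm_num
          exact hz2.1 h2
    rcases Nat.lt_or_ge k 4 with hlt | hge
    · exact (hne k hlt hk).1 hk1
    · -- `4 ≤ k < 8`: `z^k = z^4 z^{k-4} = - z^{k-4}`
      obtain ⟨j, rfl⟩ := Nat.exists_eq_add_of_le hge
      have hj : j < 4 := by omega
      rw [pow_add, hz4] at hk1
      rcases Nat.eq_zero_or_pos j with rfl | hj0
      · norm_num at hk1
      · exact (hne j hj hj0).2 (by linear_combination -hk1)
  -- degree count: `[ℚ(z) : ℚ] = φ(8) = 4` divides `[F : ℚ]`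
  have hint : IsIntegral ℚ z := (hz8.isIntegral (by norm_num)).tower_top
  have hdeg : Module.finrank ℚ ℚ⟮z⟯ = 4 := by
    rw [IntermediateField.adjoin.finrank hint, ← Polynomial.cyclotomic_eq_minpoly_rat hz8 (by norm_num),
      Polynomial.natDegree_cyclotomic]
    decide
  have hdvd := IntermediateField.finrank_dvd_of_le_right (le_top : ℚ⟮z⟯ ≤ ⊤)
  rw [IntermediateField.finrank_top', hdeg] at hdvd
  exact h4 hdvd

/-- **The cyclotomic `ℤ₂`-extension of `ℚ` restricts ONTO `Γ_F`** for `F ∋ √−1` with `4 ∤ [F:ℚ]` (`√2 ∉ F`; tree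
`surjective_comp_absGaloisRestrict_of_forall_sq_ne_two`), so `κ.restrict F _` is the `ℤ₂`-extension `F·ℚ_∞ = F(μ_{2^∞})`.
[cite: Washington1997, §13.1] -/
theorem surjective_comp_absGaloisRestrict_of_sq_eq_neg_one (κ : ZpExtension ℚ 2) (hκ : κ.IsCyclotomic)
    {x : F} (hx : x ^ 2 = -1) (h4 : ¬ 4 ∣ Module.finrank ℚ F) :
    Function.Surjective (κ.toContinuousMonoidHom.comp (absGaloisRestrict ℚ F)) :=
  surjective_comp_absGaloisRestrict_of_forall_sq_ne_two κ F hκ h4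
    (sq_ne_two_of_sq_eq_neg_one_of_not_four_dvd_finrank hx h4)

/-- **`ζ₈ ∈ F₁`.**  For a number field `F` containing `x` with `x² = −1`, with `4 ∤ [F:ℚ]`, and a cyclotomic `ℤ₂`-extension
`κ` of `F`, the first layer `F₁ = κ.layer 1` contains an element `z` with `z⁴ = −1`: `κ` is a unit twist of the restriction of
`ℚ`'s cyclotomic `ℤ₂`-extension (onto `Γ_F` by the previous theorem), whose first layer contains the image `s` of `√2 ∈ ℚ_1`
(tree `CyclotomicZp.exists_mem_layer_one_sq_eq_two_zpExtension`, `absClosureEmbedding_mem_layer_restrict`) and `x ∈ F`;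
`z = (1 + x)s/2`. [cite: Washington1997, §13.1 (`ℚ_1 = ℚ(√2)`, `L_n = L·K_n`)] -/
theorem exists_pow_four_eq_neg_one_layer_one {x : F} (hx : x ^ 2 = -1) (h4 : ¬ 4 ∣ Module.finrank ℚ F)
    (κ : ZpExtension F 2) (hκ : κ.IsCyclotomic) : ∃ z : κ.layer 1, z ^ 4 = -1 := by
  have hsurj := surjective_comp_absGaloisRestrict_of_sq_eq_neg_one (CyclotomicZp.zpExtension 2)
    (CyclotomicZp.isCyclotomic_zpExtension 2) hx h4
  have hcyc : ((CyclotomicZp.zpExtension 2).restrict F hsurj).IsCyclotomic :=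
    isCyclotomic_restrict _ (CyclotomicZp.isCyclotomic_zpExtension 2) F hsurj
  obtain ⟨u, rfl⟩ := IsCyclotomic.exists_eq_unitTwist_holds hcyc hκ
  obtain ⟨t, ht, ht2⟩ := CyclotomicZp.exists_mem_layer_one_sq_eq_two_zpExtension
  have hmem : absClosureEmbedding ℚ F t ∈ (((CyclotomicZp.zpExtension 2).restrict F hsurj).unitTwist u).layer 1 := by
    rw [layer_unitTwist]
    exact absClosureEmbedding_mem_layer_restrict _ F hsurj 1 ht
  set s : AlgebraicClosure F := absClosureEmbedding ℚ F t with hs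
  have hs2 : s ^ 2 = 2 := by rw [hs, ← map_pow, ht2, map_ofNat]
  have hxmem : algebraMap F (AlgebraicClosure F) x ∈
      (((CyclotomicZp.zpExtension 2).restrict F hsurj).unitTwist u).layer 1 := IntermediateField.algebraMap_mem _ x
  refine ⟨⟨(1 + algebraMap F (AlgebraicClosure F) x) * s / 2, ?_⟩, Subtype.ext ?_⟩
  · exact IntermediateField.div_mem _ (IntermediateField.mul_mem _ (IntermediateField.add_mem _
      (IntermediateField.one_mem _) hxmem) hmem) (ofNat_mem _ 2)
  · change ((1 + algebraMap F (AlgebraicClosure F) x) * s / 2) ^ 4 = (-1 : AlgebraicClosure F)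
    have hx' : (algebraMap F (AlgebraicClosure F) x) ^ 2 = -1 := by rw [← map_pow, hx, map_neg, map_one]
    have : ((1 + algebraMap F (AlgebraicClosure F) x) * s / 2) ^ 4 =
        ((1 + algebraMap F (AlgebraicClosure F) x) ^ 2) ^ 2 * (s ^ 2) ^ 2 / 16 := by ring
    rw [this, hs2]
    have h1 : (1 + algebraMap F (AlgebraicClosure F) x) ^ 2 = 2 * algebraMap F (AlgebraicClosure F) x := by
      linear_combination hx'
    rw [h1]
    linear_combination (1 : AlgebraicClosure F) * hx'

end LayerOne

/-! ## §3 `4 ∤ e(w|2)` forces ramification of `w` in `F₁`; Fukuda's index is `0` -/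

section Index

variable {F : Type} [Field F] [NumberField F]

omit [NumberField F] in
/-- A place of `F` containing `2` lies over `(2) ⊂ ℤ`. [folklore] -/
private theorem liesOver_span_two_of_mem' (w : HeightOneSpectrum (𝓞 F)) (hw : ((2 : ℕ) : 𝓞 F) ∈ w.asIdeal) :
    w.asIdeal.LiesOver (Ideal.span {(2 : ℤ)}) := by
  rw [Ideal.liesOver_span_iff w.isPrime.ne_top Int.prime_two, map_ofNat]
  exact_mod_cast hw

/-- **`4 ∤ e(w|2)` ⟹ `w` ramifies in `F₁`.**  For `F ∋ √−1` with `4 ∤ [F:ℚ]`, `κ` cyclotomic and a place `w ∣ 2` of `F` whose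
ramification index over `ℤ` is NOT divisible by `4`, the place `w` is ramified in `F₁ = κ.layer 1`: for a prime `Q ∣ w` of
`𝓞 F₁`, `e(Q|2) = e(w|2)·e(Q|w)` (Mathlib `Ideal.ramificationIdx_tower`) is divisible by `4` (§1, `ζ₈ ∈ F₁` by §2), so
`e(Q|w) ≠ 1`. [cite: Washington1997, §13.1] [cite: NeukirchANT1999, Ch. I §8] -/
theorem not_isUnramifiedIn_layer_one_of_not_four_dvd_ramificationIdx {x : F} (hx : x ^ 2 = -1)
    (h4 : ¬ 4 ∣ Module.finrank ℚ F) (κ : ZpExtension F 2) (hκ : κ.IsCyclotomic) {w : HeightOneSpectrum (𝓞 F)}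
    (hw : ((2 : ℕ) : 𝓞 F) ∈ w.asIdeal) (he : ¬ 4 ∣ w.asIdeal.ramificationIdx ℤ) :
    ¬ Algebra.IsUnramifiedIn (𝓞 (κ.layer 1)) w.asIdeal := by
  haveI : FiniteDimensional F (κ.layer 1) := κ.finiteDimensional_layer_holds 1
  haveI : NumberField (κ.layer 1) := NumberField.of_module_finite F _
  intro hunr
  obtain ⟨z, hz⟩ := exists_pow_four_eq_neg_one_layer_one hx h4 κ hκ
  have hzint : IsIntegral ℤ z := ⟨X ^ 4 + 1, monic_X_pow_add_C _ (by norm_num), by simp [hz]⟩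
  set z' : 𝓞 (κ.layer 1) := ⟨z, hzint⟩ with hz'
  have hz'4 : z' ^ 4 = -1 := by
    apply Subtype.ext
    change ((z' ^ 4 : 𝓞 (κ.layer 1)) : κ.layer 1) = ((-1 : 𝓞 (κ.layer 1)) : κ.layer 1)
    push_cast
    exact hz
  haveI : w.asIdeal.IsPrime := w.isPrime
  haveI := liesOver_span_two_of_mem' w hw
  obtain ⟨⟨Q, hQprime, hQover⟩⟩ :=
    (inferInstance : Nonempty (Ideal.primesOver w.asIdeal (𝓞 (κ.layer 1))))
  haveI := hQprime
  haveI := hQover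
  haveI : Q.LiesOver (Ideal.span {(2 : ℤ)}) := Ideal.LiesOver.trans Q w.asIdeal _
  have h1 : Q.ramificationIdx (𝓞 F) = 1 := hunr.ramificationIdx_eq_one hQover
  have h4dvd := four_dvd_ramificationIdx_int_of_pow_four_eq_neg_one hz'4 Q
  rw [Ideal.ramificationIdx_tower w.asIdeal Q, h1, mul_one] at h4dvd
  exact he h4dvd

/-- **Fukuda's index is `0` when no prime above `2` has `4 ∣ e(w|2)`.**  For a number field `F ∋ √−1` with `4 ∤ [F:ℚ]` and a
cyclotomic `ℤ₂`-extension `κ` of `F`: if every place `w ∣ 2` of `F` has `4 ∤ e(w|2)`, then every prime is unramified or TOTALLY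
ramified in `F_∞/F`, i.e. `TotallyRamifiedFrom κ 0` (every `w ∣ 2` ramifies in `F₁`; tree `ZpExtensionTotallyRamifiedFromLayerOne`).
[cite: Washington1997, §13.1 Lemma 13.3 (proof)] [cite: Fukuda1994, p. 264] -/
theorem totallyRamifiedFrom_zero_of_sq_eq_neg_one_of_forall_not_four_dvd {x : F} (hx : x ^ 2 = -1)
    (h4 : ¬ 4 ∣ Module.finrank ℚ F) (κ : ZpExtension F 2) (hκ : κ.IsCyclotomic)
    (he : ∀ w : HeightOneSpectrum (𝓞 F), ((2 : ℕ) : 𝓞 F) ∈ w.asIdeal → ¬ 4 ∣ w.asIdeal.ramificationIdx ℤ) :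
    TotallyRamifiedFrom κ 0 :=
  totallyRamifiedFrom_zero_of_forall_not_isUnramifiedIn_layer_one κ fun w hw =>
    not_isUnramifiedIn_layer_one_of_not_four_dvd_ramificationIdx hx h4 κ hκ hw (he w hw)

/-- **One prime above `2`: `e(w|2) ∣ [F:ℚ]`.**  If `𝓞 F` has exactly ONE prime `w` above `2` then the fundamental identity
`∑_{Q ∣ 2} e(Q|2) f(Q|2) = [F:ℚ]` (Mathlib `Ideal.sum_ramification_inertia`) has the single term `e(w|2) f(w|2)`.
[cite: NeukirchANT1999, Ch. I §8, Prop. (8.2) (`Σ eᵢ fᵢ = n`)] -/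
theorem ramificationIdx_dvd_finrank_of_existsUnique_two_mem
    (hF : ∃! w : HeightOneSpectrum (𝓞 F), ((2 : ℕ) : 𝓞 F) ∈ w.asIdeal)
    (w : HeightOneSpectrum (𝓞 F)) (hw : ((2 : ℕ) : 𝓞 F) ∈ w.asIdeal) :
    w.asIdeal.ramificationIdx ℤ ∣ Module.finrank ℚ F := by
  classical
  haveI : (Ideal.span {(2 : ℤ)}).IsMaximal :=
    Ideal.IsPrime.isMaximal ((Ideal.span_singleton_prime two_ne_zero).mpr Int.prime_two) (by simp)
  have h20 : (Ideal.span {(2 : ℤ)} : Ideal ℤ) ≠ ⊥ := by simp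
  haveI : w.asIdeal.IsPrime := w.isPrime
  have hw2 : (2 : 𝓞 F) ∈ w.asIdeal := by exact_mod_cast hw
  haveI hwl : w.asIdeal.LiesOver (Ideal.span {(2 : ℤ)}) := by
    rw [Ideal.liesOver_span_iff w.isPrime.ne_top Int.prime_two, map_ofNat]; exact hw2
  -- the set of primes above `2` is `{w}`
  have hS : IsDedekindDomain.primesOverFinset (Ideal.span {(2 : ℤ)}) (𝓞 F) = {w.asIdeal} := by
    refine Finset.eq_singleton_iff_unique_mem.mpr
      ⟨(IsDedekindDomain.mem_primesOverFinset_iff h20 _).mpr ⟨w.isPrime, hwl⟩, ?_⟩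
    intro P hP
    obtain ⟨hPp, hPl⟩ := (IsDedekindDomain.mem_primesOverFinset_iff h20 _).mp hP
    have hP2 : (2 : 𝓞 F) ∈ P := by
      have := (Ideal.liesOver_span_iff hPp.ne_top Int.prime_two).mp hPl; rwa [map_ofNat] at this
    have hP0 : P ≠ ⊥ := fun h => by rw [h, Ideal.mem_bot] at hP2; exact two_ne_zero hP2
    obtain ⟨v, -, huniq⟩ := hF
    have h1 := huniq ⟨P, hPp, hP0⟩ (by exact_mod_cast hP2)
    have h2 := huniq w hw
    exact congrArg HeightOneSpectrum.asIdeal (h1.trans h2.symm)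
  have hsum := Ideal.sum_ramification_inertia (R := ℤ) (𝓞 F) ℚ F (p := Ideal.span {(2 : ℤ)}) h20
  rw [hS, Finset.sum_singleton, Ideal.ramificationIdx'_eq_ramificationIdx _ _ h20] at hsum
  exact ⟨_, hsum.symm⟩

/-- **One prime above `2` ⟹ Fukuda's index is `0`** for `F ∋ √−1` with `4 ∤ [F:ℚ]`: if `𝓞 F` has exactly ONE prime `w` above `2`
then `e(w|2) ∣ [F:ℚ]` is not divisible by `4`, and the previous theorem applies.  (The shape met by `F = E(√−1)`, `E` of odd
degree with one prime above `2`.) [cite: Washington1997, §13.1 Lemma 13.3] [cite: NeukirchANT1999, Ch. I §8 (fundamental identity)]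
[cite: Fukuda1994, p. 264] -/
theorem totallyRamifiedFrom_zero_of_sq_eq_neg_one_of_existsUnique {x : F} (hx : x ^ 2 = -1)
    (h4 : ¬ 4 ∣ Module.finrank ℚ F)
    (hF : ∃! w : HeightOneSpectrum (𝓞 F), ((2 : ℕ) : 𝓞 F) ∈ w.asIdeal)
    (κ : ZpExtension F 2) (hκ : κ.IsCyclotomic) : TotallyRamifiedFrom κ 0 :=
  totallyRamifiedFrom_zero_of_sq_eq_neg_one_of_forall_not_four_dvd hx h4 κ hκ fun w hw hdvd =>
    h4 (hdvd.trans (ramificationIdx_dvd_finrank_of_existsUnique_two_mem hF w hw))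

/-- Consumer form («`∀ κ` cyclotomic») of `totallyRamifiedFrom_zero_of_sq_eq_neg_one_of_existsUnique`: the binder `hram` of the
tree's Fukuda doors for a field `F ∋ √−1` with `4 ∤ [F:ℚ]` and one prime above `2`. [cite: Fukuda1994, p. 264] -/
theorem forall_totallyRamifiedFrom_zero_of_sq_eq_neg_one_of_existsUnique {x : F} (hx : x ^ 2 = -1)
    (h4 : ¬ 4 ∣ Module.finrank ℚ F)
    (hF : ∃! w : HeightOneSpectrum (𝓞 F), ((2 : ℕ) : 𝓞 F) ∈ w.asIdeal) :
    ∀ κ : ZpExtension F 2, κ.IsCyclotomic → TotallyRamifiedFrom κ 0 :=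
  fun κ hκ => totallyRamifiedFrom_zero_of_sq_eq_neg_one_of_existsUnique hx h4 hF κ hκ

end Index

end Literature.NumberTheory.IwasawaTheory

end
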